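import Literature.Computability.QuantumComplexity.QuantumTuringADHProofs
import Literature.Computability.QuantumComplexity.QuantumTuringProofs
import HarnessLib

/-!
# `BQP_θ = BQP_BV` in Bernstein–Vazirani's own model: the Adleman–DeMarrais–Huang glue for the positioned classes

Addendum to `QuantumTuringADHProofs.lean` (quantum-advantage S05, the named fact
`Literature.Computability.QuantumComplexity.BQPQTMWith_adhAmplitudes : BQPQTMWith adhAmplitudes = BQPQTM`,
whose glue `BQPQTM_subset_BQPQTMWith_of hBoost hSim` is stated there in the TREE's
translation-quotient semantics `QTM.IsWellFormed` / `QTM.acceptProbAt`). Adleman–DeMarrais–Huang,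
SIAM J. Comput. 26 (1997), Def. 2.1 (`BQP_T`), §2.1 (`T₁ ⪯ T₂ ⇒ BQP_{T₁} ⊆ BQP_{T₂}`), Thm. 3.1,
Cor. 3.2 and Thm. 3.3(e) are statements about Bernstein–Vazirani machines with ABSOLUTE head
positions, i.e. about the positioned classes `BQPQTMPosWith S` / `BQPQTMPos` of
`Cryptography/QuantumTuringMachinePositioned.lean` (`QTM.PIsWellFormed`, `QTM.pacceptProbAt`).
This file records the same class-level glue for those faithful classes, so that the printed
constructions (Bernstein–Vazirani 1997, §4 and Thm. 7.1; Bennett–Bernstein–Brassard–Vazirani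
1997, Thm. 4.13; ADH Thm. 3.3(e) with Lemma 3.5 — `adlemanDeMarraisHuang_lemma_3_5_adhAngle` of
`QuantumTuringADHAngle.lean` — and the perturbation bounds of
`Cryptography/QuantumTuringMachinePrecision.lean`), once carried out in the model in which they
are proved, close the faithful identity `BQPQTMPosWith adhAmplitudes = BQPQTMPos` by
`BQPQTMPosWith_adhAmplitudes_eq_of`:

* `BQPQTMPosWith_adhAmplitudes_subset_BQPQTMPos` — the inclusion `⊆`, PROVED (monotonicity in the
  amplitude set and `adhAmplitudes ⊆ polyTimeComputableComplex`);
* `BQPQTMPos_subset_BQPQTMPosWith_of hBoostPos hSimPos` — ADH §2.1 for the positioned classes and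
  an arbitrary target amplitude set `S` (boost to `(11/12, 1/12)`, simulate within `1/12`);
* `BQPQTMPosWith_adhAmplitudes_eq_of` — both inclusions.

That identity is NOT vendored as a named fact here (D-0026; it is the faithful reading of S05 and
its adoption is an operator decision, cf. the review record in `QuantumTuring.lean`). No
definition and no named fact is introduced.

## References

* L. M. Adleman, J. DeMarrais, M.-D. A. Huang, *Quantum computability*, SIAM J. Comput. 26
  (1997) 1524–1540 [AdlemanDeMarraisHuangSICOMP1997]: Def. 2.1, §2.1, Thm. 3.1, Cor. 3.2,
  Thm. 3.3(e), pp. 1526–1530.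
* E. Bernstein, U. Vazirani, *Quantum complexity theory*, SIAM J. Comput. 26 (1997) 1411–1473
  [BernsteinVaziraniSICOMP1997]: Def. 3.2–3.4, §4, Thm. 7.1, §8.
* C. H. Bennett, E. Bernstein, G. Brassard, U. Vazirani, *Strengths and weaknesses of quantum
  computing*, SIAM J. Comput. 26 (1997) 1510–1523 [BennettBernsteinBrassardVazirani1997]: Thm. 4.13.
-/

namespace Literature.Computability.QuantumComplexity

open Cryptography Complexity

/-- **`BQPQTMPosWith adhAmplitudes ⊆ BQPQTMPos`** (the easy inclusion of Adleman–DeMarrais–Huang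
1997, Cor. 3.2, `BQP_ℚ ⊆ BQP_poly(1/ε)`, p. 1527, for the positioned classes): amplitudes in
`{0, ±3/5, ±4/5, ±1}` are polynomial-time computable and `BQPQTMPosWith` is monotone. [cite: AdlemanDeMarraisHuangSICOMP1997, Cor. 3.2 (easy inclusion) p. 1527] -/
theorem BQPQTMPosWith_adhAmplitudes_subset_BQPQTMPos : BQPQTMPosWith adhAmplitudes ⊆ BQPQTMPos :=
  BQPQTMPosWith_mono adhAmplitudes_subset_polyTimeComputableComplex_holds

/-- **`T₁ ⪯ T₂ ⇒ BQP_{T₁} ⊆ BQP_{T₂}` for the positioned classes** (Adleman–DeMarrais–Huang 1997,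
§2.1, p. 1526, "requires a short proof which will not be given here"; as
`BQPQTM_subset_BQPQTMWith_of`, with Bernstein–Vazirani well-formedness `QTM.PIsWellFormed` and
positioned acceptance probabilities `QTM.pacceptProbAt`). `hBoostPos`: error reduction inside
BV machines with polynomial-time computable amplitudes, `(2/3, 1/3)` at time `p(|x|)` to
`(11/12, 1/12)` at a polynomial time (BBBV 1997, Thm. 4.13); `hSimPos`: simulation of every such
machine within any `ε > 0` in acceptance probability by a BV-well-formed machine with amplitudes
in `S` (for `S = adhAmplitudes`: BV 1997 Thm. 7.1 with ADH Thm. 3.3(e)). [cite: AdlemanDeMarraisHuangSICOMP1997, §2.1 (remark `T₁ ⪯ T₂ ⇒ BQP_T₁ ⊆ BQP_T₂`) p. 1526] -/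
theorem BQPQTMPos_subset_BQPQTMPosWith_of {S : Set ℂ}
    (hBoostPos : ∀ (M : QTM) (p : Polynomial ℕ), M.PIsWellFormed →
      M.amplitudes ⊆ polyTimeComputableComplex →
        ∃ (M₁ : QTM) (p₁ : Polynomial ℕ), M₁.PIsWellFormed ∧
          M₁.amplitudes ⊆ polyTimeComputableComplex ∧
          ∀ x : List Bool,
            ((2 / 3 : ℝ) ≤ M.pacceptProbAt x (p.eval x.length) →
                (11 / 12 : ℝ) ≤ M₁.pacceptProbAt x (p₁.eval x.length)) ∧
              (M.pacceptProbAt x (p.eval x.length) ≤ (1 / 3 : ℝ) →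
                M₁.pacceptProbAt x (p₁.eval x.length) ≤ (1 / 12 : ℝ)))
    (hSimPos : ∀ (M : QTM) (p : Polynomial ℕ) (ε : ℝ), M.PIsWellFormed →
      M.amplitudes ⊆ polyTimeComputableComplex → 0 < ε →
        ∃ (M' : QTM) (p' : Polynomial ℕ), M'.PIsWellFormed ∧ M'.amplitudes ⊆ S ∧
          ∀ x : List Bool,
            |M'.pacceptProbAt x (p'.eval x.length) - M.pacceptProbAt x (p.eval x.length)| ≤ ε) :
    BQPQTMPos ⊆ BQPQTMPosWith S := by
  rintro L ⟨M, p, hwf, hamp, hM⟩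
  obtain ⟨M₁, p₁, hwf₁, hamp₁, hM₁⟩ := hBoostPos M p hwf hamp
  obtain ⟨M', p', hwf', hamp', hM'⟩ := hSimPos M₁ p₁ (1 / 12) hwf₁ hamp₁ (by norm_num)
  refine ⟨M', p', hwf', hamp', fun x => ⟨fun hx => ?_, fun hx => ?_⟩⟩
  · have h1 : (11 / 12 : ℝ) ≤ M₁.pacceptProbAt x (p₁.eval x.length) :=
      (hM₁ x).1 ((hM x).1 hx)
    have h2 := (abs_le.1 (hM' x)).1
    linarith
  · have h1 : M₁.pacceptProbAt x (p₁.eval x.length) ≤ (1 / 12 : ℝ) :=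
      (hM₁ x).2 ((hM x).2 hx)
    have h2 := (abs_le.1 (hM' x)).2
    linarith

/-- **Adleman–DeMarrais–Huang's Corollary 3.2 in Bernstein–Vazirani's model, glued**: boosting
(`hBoostPos`) and the `θ`-simulation of BV machines (`hSimPos` at `S = adhAmplitudes`) give the
faithful identity `BQPQTMPosWith adhAmplitudes = BQPQTMPos`; the inclusion `⊆` is
unconditional (`BQPQTMPosWith_adhAmplitudes_subset_BQPQTMPos`). [cite: AdlemanDeMarraisHuangSICOMP1997, Thm. 3.1 and Cor. 3.2 with Thm. 3.3(e)] -/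
theorem BQPQTMPosWith_adhAmplitudes_eq_of
    (hBoostPos : ∀ (M : QTM) (p : Polynomial ℕ), M.PIsWellFormed →
      M.amplitudes ⊆ polyTimeComputableComplex →
        ∃ (M₁ : QTM) (p₁ : Polynomial ℕ), M₁.PIsWellFormed ∧
          M₁.amplitudes ⊆ polyTimeComputableComplex ∧
          ∀ x : List Bool,
            ((2 / 3 : ℝ) ≤ M.pacceptProbAt x (p.eval x.length) →
                (11 / 12 : ℝ) ≤ M₁.pacceptProbAt x (p₁.eval x.length)) ∧
              (M.pacceptProbAt x (p.eval x.length) ≤ (1 / 3 : ℝ) →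
                M₁.pacceptProbAt x (p₁.eval x.length) ≤ (1 / 12 : ℝ)))
    (hSimPos : ∀ (M : QTM) (p : Polynomial ℕ) (ε : ℝ), M.PIsWellFormed →
      M.amplitudes ⊆ polyTimeComputableComplex → 0 < ε →
        ∃ (M' : QTM) (p' : Polynomial ℕ), M'.PIsWellFormed ∧ M'.amplitudes ⊆ adhAmplitudes ∧
          ∀ x : List Bool,
            |M'.pacceptProbAt x (p'.eval x.length) - M.pacceptProbAt x (p.eval x.length)| ≤ ε) :
    BQPQTMPosWith adhAmplitudes = BQPQTMPos :=
  Set.Subset.antisymm BQPQTMPosWith_adhAmplitudes_subset_BQPQTMPos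
    (BQPQTMPos_subset_BQPQTMPosWith_of hBoostPos hSimPos)

end Literature.Computability.QuantumComplexity
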